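import Summits.QuantumAdvantage.QuantumAdvantage.Theorems.CubicForrelationNearExactIsExactFourteenSecondDigits
import Summits.QuantumAdvantage.QuantumAdvantage.Theorems.CubicForrelationNearExactIsExactZeroModSixDigits

/-!
# Crux `CubicForrelation.NearExactIsExact` (stmt-QuantumAdvantage-14043) — `n = 6r+2`: cube sums and the Walsh digits of a cubic
  (digit one quadratic; digit two CUBIC when the radical of digit one is large), uniform in `r`

Certificate seat `b2b-cforr-cert` (gen 9).  HONEST FRAMING: lemmas about cubic Boolean functions on `6r+2` bits (inputs to the type-O analysis at
the second dyadic boundary on `n ≡ 2 (mod 6)`), generalising the 14-bit `fd_digitOne` / `fo_digitTwo_cubic` — NOT summit progress.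

With `W_g = 2^{2r+1}u` (Ax): `tm2_cube_sum` (`2^{2r+1}Σ_{E_I} u = 2^{|I|}·2^{⌈(n−|I|)/3⌉}·z`), `tm2_digitOne` (type O ⇒ `d₁ = [⌊u/2⌋ odd]` has
degree `≤ 2`), `tm2_digitTwo_cubic` (if moreover the radical `R` of `d₁` has `#R ≥ 2^{6r}`, i.e. rank `d₁ ≤ 2`, then `d₂ = [⌊u/4⌋ odd]` has
degree `≤ 3`: a radical vector inside every coordinate 4-cube, `fo_card_mul_le_inter` + `fo_quad_cube4`).

References: J. Ax (1964) / R. J. McEliece (1972); C. Carlet (2021) §4.1, §5.2.  Everything below is proved from Mathlib and the tree;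
axioms are the standard three.
-/

set_option linter.dupNamespace false -- D-0017: single-problem summit ⇒ `QuantumAdvantage.QuantumAdvantage` by design

noncomputable section

namespace Summit.QuantumAdvantage.QuantumAdvantage.Theorems.CubicForrelation.NearExactIsExact

open Finset
open Literature.Computability.QuantumComplexity
open Literature.Computability.QuantumComplexity.BuzetChailloux (bxor zeroVec bxor_bxor_cancel_left bxor_zeroVec zeroVec_bxor bxor_comm
  bxor_self)
open Literature.Computability.QuantumComplexity.DerivativeWalsh (W)

section TwoModSixSecondDigits

variable (r : ℕ) (g : (Fin ((3 * r + 1) + (3 * r + 1)) → Bool) → Bool) (u : (Fin ((3 * r + 1) + (3 * r + 1)) → Bool) → ℤ)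

/-- The cube sums of `u = W_g/2^{2r+1}` for a cubic `g` on `6r+2` bits: `2^{2r+1}·Σ_{E_I} u = 2^{|I|}·2^{⌈(6r+2−|I|)/3⌉}·z`.
[cite: Carlet2020, §4.1] -/
theorem tm2_cube_sum (hg : IsDegLeFun 3 g) (hu : ∀ x, W (fun y => signOf (g y)) x = (2 : ℝ) ^ (2 * r + 1) * (u x : ℝ))
    (I : Finset (Fin ((3 * r + 1) + (3 * r + 1)))) :
    ∃ z : ℤ, (2 : ℤ) ^ (2 * r + 1) * ∑ x ∈ {x : Fin ((3 * r + 1) + (3 * r + 1)) → Bool | ∀ i, x i = true → i ∈ I}, u x =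
      2 ^ #I * (2 ^ (((3 * r + 1) + (3 * r + 1) - #I + 2) / 3) * z) := by
  have hP := bb_poisson (fun y => signOf (g y)) I
  obtain ⟨z, hz⟩ := stub_axParity ((3 * r + 1) + (3 * r + 1)) 3 g Iᶜ (by norm_num) hg
  have hj : #Iᶜ = (3 * r + 1) + (3 * r + 1) - #I := by rw [card_compl, Fintype.card_fin]
  rw [hj, show ((3 * r + 1) + (3 * r + 1) - #I + 3 - 1) / 3 = ((3 * r + 1) + (3 * r + 1) - #I + 2) / 3 by omega] at hz
  rw [sum_congr rfl fun x _ => hu x, ← mul_sum, hz] at hP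
  refine ⟨z, ?_⟩
  have h' : (((2 : ℤ) ^ (2 * r + 1) * ∑ x ∈ {x : Fin ((3 * r + 1) + (3 * r + 1)) → Bool | ∀ i, x i = true → i ∈ I}, u x : ℤ) : ℝ) =
      (((2 : ℤ) ^ #I * (2 ^ (((3 * r + 1) + (3 * r + 1) - #I + 2) / 3) * z) : ℤ) : ℝ) := by
    push_cast at hP ⊢
    linarith
  exact_mod_cast h'

/-- For type O the odd points of a cube are all of it. -/
theorem tm2_card_odd_cube (hodd : ∀ x, Odd (u x)) (I : Finset (Fin ((3 * r + 1) + (3 * r + 1)))) :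
    (#(({x : Fin ((3 * r + 1) + (3 * r + 1)) → Bool | ∀ i, x i = true → i ∈ I} : Finset _).filter fun x => Odd (u x)) : ℤ) = 2 ^ #I := by
  rw [filter_true_of_mem fun x _ => hodd x, bb_card_cube]
  push_cast
  rfl

/-- **Digit one (type O, `6r+2` bits).** If every `u(x)` is odd then `d₁ = [⌊u/2⌋ odd]` has degree `≤ 2`: for `|I| ≥ 3`,
`Σ_{E_I} u ≡ 0 (mod 4)` and `Σ_{E_I} u = 2·Σ⌊u/2⌋ + 2^{|I|}`. [this work] -/
theorem tm2_digitOne (hg : IsDegLeFun 3 g) (hu : ∀ x, W (fun y => signOf (g y)) x = (2 : ℝ) ^ (2 * r + 1) * (u x : ℝ))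
    (hodd : ∀ x, Odd (u x)) : IsDegLeFun 2 (fun x => decide (Odd (u x / 2))) := by
  refine bb_moebius_isDegLeFun 2 _ fun I hI => ?_
  have hk : #I ≤ (3 * r + 1) + (3 * r + 1) := (card_le_univ I).trans_eq (Fintype.card_fin _)
  obtain ⟨z, hz⟩ := tm2_cube_sum r g u hg hu I
  have h4 : (2 : ℤ) ^ 2 ∣ ∑ x ∈ {x : Fin ((3 * r + 1) + (3 * r + 1)) → Bool | ∀ i, x i = true → i ∈ I}, u x :=
    sx_dvd_of_balance (by omega) hz
  have hsplit : ∑ x ∈ {x : Fin ((3 * r + 1) + (3 * r + 1)) → Bool | ∀ i, x i = true → i ∈ I}, u x =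
      2 * ∑ x ∈ {x : Fin ((3 * r + 1) + (3 * r + 1)) → Bool | ∀ i, x i = true → i ∈ I}, u x / 2 + 2 ^ #I := by
    rw [sum_congr rfl fun x _ => td_two_mul_div_add (u x), sum_add_distrib, ← mul_sum, td_sum_ite_odd,
      tm2_card_odd_cube r u hodd I]
  obtain ⟨e, he⟩ : ∃ e, #I = e + 2 := ⟨#I - 2, by omega⟩
  have hE : Even (∑ x ∈ {x : Fin ((3 * r + 1) + (3 * r + 1)) → Bool | ∀ i, x i = true → i ∈ I}, u x / 2) := by
    rw [pow_two] at h4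
    obtain ⟨q, hq⟩ := h4
    rw [he, pow_add] at hsplit
    refine ⟨q - 2 ^ e, ?_⟩
    nlinarith
  have hE' := (tw_even_sum_iff _ (fun x => u x / 2)).1 hE
  rw [filter_filter] at hE'
  simpa only [decide_eq_true_eq] using hE'

/-- **Digit two is CUBIC when `rank d₁ ≤ 2` (type O, `6r+2` bits).**  If every `u(x)` is odd and the radical
`R = {a : d₁(0) ⊕ d₁(a) ⊕ d₁(b) ⊕ d₁(a ⊕ b) = 0 ∀ b}` has `#R ≥ 2^{6r}`, then `d₂ = [⌊u/4⌋ odd]` has degree `≤ 3`. [this work] -/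
theorem tm2_digitTwo_cubic (hg : IsDegLeFun 3 g) (hu : ∀ x, W (fun y => signOf (g y)) x = (2 : ℝ) ^ (2 * r + 1) * (u x : ℝ))
    (hodd : ∀ x, Odd (u x))
    (hrad : 2 ^ (6 * r) ≤ #(univ.filter fun a : Fin ((3 * r + 1) + (3 * r + 1)) → Bool => ∀ b,
      (decide (Odd (u zeroVec / 2)) ^^ decide (Odd (u a / 2)) ^^ decide (Odd (u b / 2)) ^^ decide (Odd (u (bxor a b) / 2))) = false)) :
    IsDegLeFun 3 (fun x => decide (Odd (u x / 2 / 2))) := by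
  classical
  have hP1 := tm2_digitOne r g u hg hu hodd
  set R := univ.filter (fun a : Fin ((3 * r + 1) + (3 * r + 1)) → Bool => ∀ b,
      (decide (Odd (u zeroVec / 2)) ^^ decide (Odd (u a / 2)) ^^ decide (Odd (u b / 2)) ^^ decide (Odd (u (bxor a b) / 2))) = false)
    with hRdef
  have haddR : ∀ a ∈ R, ∀ a' ∈ R, bxor a a' ∈ R := by
    intro a ha a' ha'
    refine mem_filter.2 ⟨mem_univ _, fun b => ?_⟩
    rw [es_B_add_left (fun x => decide (Odd (u x / 2))) hP1 a a' b, (mem_filter.1 ha).2 b, (mem_filter.1 ha').2 b]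
    rfl
  refine bb_moebius_isDegLeFun 3 _ fun I hI => ?_
  have hk : #I ≤ (3 * r + 1) + (3 * r + 1) := (card_le_univ I).trans_eq (Fintype.card_fin _)
  obtain ⟨z, hz⟩ := tm2_cube_sum r g u hg hu I
  have h8 : (2 : ℤ) ^ 3 ∣ ∑ x ∈ {x : Fin ((3 * r + 1) + (3 * r + 1)) → Bool | ∀ i, x i = true → i ∈ I}, u x :=
    sx_dvd_of_balance (by omega) hz
  have hB : (4 : ℤ) ∣ #{x : Fin ((3 * r + 1) + (3 * r + 1)) → Bool | (∀ i, x i = true → i ∈ I) ∧ decide (Odd (u x / 2)) = true} := by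
    by_cases h4 : #I = 4
    · set C := univ.filter (fun a : Fin ((3 * r + 1) + (3 * r + 1)) → Bool => ∀ i, a i = true → i ∈ I) with hCdef
      have haddC : ∀ a ∈ C, ∀ a' ∈ C, bxor a a' ∈ C := by
        intro a ha a' ha'
        refine mem_filter.2 ⟨mem_univ _, fun i hi => ?_⟩
        simp only [bxor] at hi
        cases hai : a i with
        | true => exact (mem_filter.1 ha).2 i hai
        | false => rw [hai] at hi; exact (mem_filter.1 ha').2 i (by simpa using hi)
      have hRC := fo_card_mul_le_inter R C haddR haddC
      have hCcard : #C = 16 := by rw [hCdef, bb_card_cube, h4]; norm_num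
      have hN : (2 : ℕ) ^ ((3 * r + 1) + (3 * r + 1)) = 4 * 2 ^ (6 * r) := by ring
      rw [hCcard, hN] at hRC
      have h2 : 1 < #(R ∩ C) := by
        have hX : 0 < 2 ^ (6 * r) := Nat.two_pow_pos _
        have : 2 ^ (6 * r) * 16 ≤ 4 * 2 ^ (6 * r) * #(R ∩ C) := (Nat.mul_le_mul_right 16 hrad).trans hRC
        nlinarith
      obtain ⟨a, ha, ha0⟩ := exists_mem_ne h2 zeroVec
      have haR : a ∈ R := (mem_inter.1 ha).1
      have haC : ∀ i, a i = true → i ∈ I := (mem_filter.1 (mem_inter.1 ha).2).2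
      exact fo_quad_cube4 (fun x => decide (Odd (u x / 2))) hP1 I h4 a haC ha0 (mem_filter.1 haR).2
    · obtain ⟨z'', hz''⟩ := td_count_cube (by norm_num : 1 ≤ 2) (fun x => decide (Odd (u x / 2))) hP1 I
      obtain ⟨e, he⟩ : ∃ e, #I = e + 5 := ⟨#I - 5, by omega⟩
      obtain ⟨e', he'⟩ : ∃ e', (#I + 2 - 1) / 2 = e' + 3 := ⟨(#I + 2 - 1) / 2 - 3, by omega⟩
      rw [he', he, show (2 : ℤ) ^ (e + 5) = 2 ^ e * 32 by rw [pow_add]; norm_num,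
        show (2 : ℤ) ^ (e' + 3) = 2 ^ e' * 8 by rw [pow_add]; norm_num] at hz''
      exact ⟨2 ^ e * 4 - 2 ^ e' * z'', by linarith⟩
  have hsplit : ∑ x ∈ {x : Fin ((3 * r + 1) + (3 * r + 1)) → Bool | ∀ i, x i = true → i ∈ I}, u x =
      2 * (2 * ∑ x ∈ {x : Fin ((3 * r + 1) + (3 * r + 1)) → Bool | ∀ i, x i = true → i ∈ I}, u x / 2 / 2 +
        #{x : Fin ((3 * r + 1) + (3 * r + 1)) → Bool | (∀ i, x i = true → i ∈ I) ∧ decide (Odd (u x / 2)) = true}) + 2 ^ #I := by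
    rw [sum_congr rfl fun x _ => td_two_mul_div_add (u x), sum_add_distrib, ← mul_sum, td_sum_ite_odd,
      tm2_card_odd_cube r u hodd I, sum_congr rfl fun x _ => td_two_mul_div_add (u x / 2), sum_add_distrib, ← mul_sum,
      td_sum_ite_odd, filter_filter]
    simp only [decide_eq_true_eq]
  obtain ⟨e, he⟩ : ∃ e, #I = e + 3 := ⟨#I - 3, by omega⟩
  have hE : Even (∑ x ∈ {x : Fin ((3 * r + 1) + (3 * r + 1)) → Bool | ∀ i, x i = true → i ∈ I}, u x / 2 / 2) := by
    obtain ⟨q, hq⟩ := h8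
    obtain ⟨b, hb⟩ := hB
    rw [hq, hb, he, pow_add] at hsplit
    refine ⟨q - b - 2 ^ e, ?_⟩
    nlinarith
  have hE' := (tw_even_sum_iff _ (fun x => u x / 2 / 2)).1 hE
  rw [filter_filter] at hE'
  simpa only [decide_eq_true_eq] using hE'

end TwoModSixSecondDigits

end Summit.QuantumAdvantage.QuantumAdvantage.Theorems.CubicForrelation.NearExactIsExact

end
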